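import Literature.MathematicalPhysics.QuantumLattice.GrassmannKernelYoung
import Literature.MathematicalPhysics.QuantumLattice.GrassmannEffectiveActionNorm
import HarnessLib

/-!
# The single-scale step read in another representation of the fields (sector fields, position fields, …)

Topic `MathematicalPhysics/QuantumLattice`; assembly of `GrassmannEffectiveActionNorm.lean` (the single-scale
renormalisation-group step `‖kernel_m (effAction C V)‖_{1,∞} ≤ ρ^{-m} e‖V‖_h/(1 - θ)` on an abstract label set),
`GrassmannLinearSubstitution.lean` (`effAction C (map f Ṽ) = map f (effAction (Mᵀ C M) Ṽ)`, `effPartitionFn_map`)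
and `GrassmannKernelYoung.lean` (`‖kernel (map g F)‖ ≤ cr cc^m ‖kernel F‖`).  The situation of Benfatto–Giuliani–
Mastropietro 2006, §2.5–2.8: the interaction `V` of the PHYSICAL fields `ψ` (labels `Γ`, e.g. momenta) is
rewritten as a polynomial `Ṽ` of auxiliary fields `ψ'` (labels `Γ'`, e.g. position-space SECTOR fields) along a
substitution `f` (`ψ'(X') ↦ Σ_X M(X, X') ψ(X)`, `map f Ṽ = V`); the Gaussian integration is performed on the
auxiliary fields with the pulled-back covariance `C' = Mᵀ C M` (the sector propagators), where the tree / Gram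
bounds hold with constants `(κ, α)`; and the OUTPUT `effAction C V` is read through an analysis map `g`
(`ψ(X) ↦ Σ_{X''} E(X'', X) ψ''(X'')`, e.g. the sector decomposition of the external fields at the next scale),
whose kernels are those of `effAction C' Ṽ` convolved leg by leg with `E M` (Young: `cr cc^m`):

* `kernelNorm_eq_pow_mul_kernelNorm_one` — `kernelNorm ε (m+1) K = ε^m · kernelNorm 1 (m+1) K`;
* `map_map_eq_map_comp` — `map g (map f a) = map (g ∘ f) a`;
* **`kernelNorm_kernel_map_effAction_le`** — with `θ = eα‖Ṽ‖_h/κ² < 1` (the norm `‖Ṽ‖_h = normV Γ' κ ρ (kernelNorm 1 …)`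
  of the AUXILIARY representation): `∫ dμ_C e^{-V}` is a unit and, in every degree `m + 1`,
  `‖kernel (map g (effAction C V)) (m+1)‖_{ε} ≤ cr · cc^m · ε^m · ρ^{-(m+1)} · e‖Ṽ‖_h/(1 - θ)`
  where `cr, cc` bound the row and column sums of `‖E M‖` (BGM 2006, (2.77) with (2.71a), (2.80)–(2.82)).

Everything is proved; no definitions, no named facts.  The three analytic inputs of a model instance are thus
separated: the norm of the sectorised interaction `‖Ṽ‖_h` (sector counting), the constants `(κ, α)` of the sector
propagators `Mᵀ C M`, and the multiplier costs `(cr, cc)` of `E M`.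

## Sources

G. Benfatto, A. Giuliani, V. Mastropietro, Ann. Henri Poincaré 7 (2006) 809–898, §2.5 (2.44)–(2.48), §2.7
(2.66)–(2.73), §2.8 (2.76)–(2.83) [`BenfattoGiulianiMastropietro2006`]; M. Salmhofer, Commun. Math. Phys. 194
(1998) 249–295, §4.1 [`Salmhofer1998`].
-/

noncomputable section

namespace Literature.MathematicalPhysics.QuantumLattice

open GrassmannAlgebra Finset Literature.Probability.LatticeModels
open scoped InnerProductSpace

variable {𝕜 : Type*} [RCLike 𝕜] {Γ Γ' Γ'' : Type*} [Fintype Γ] [DecidableEq Γ] [Fintype Γ'] [DecidableEq Γ']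
  [Fintype Γ''] [DecidableEq Γ'']

/-- **Scaling of the norm in the integration weight**: `kernelNorm ε (m+1) K = ε^m · kernelNorm 1 (m+1) K` for
`ε ≥ 0`. [folklore] -/
theorem kernelNorm_eq_pow_mul_kernelNorm_one {ε : ℝ} (hε : 0 ≤ ε) (m : ℕ) (K : (Fin (m + 1) → Γ) → 𝕜) :
    kernelNorm ε (m + 1) K = ε ^ m * kernelNorm 1 (m + 1) K := by
  rw [kernelNorm_succ, kernelNorm_succ, Real.mul_iSup_of_nonneg (pow_nonneg hε _)]
  refine iSup_congr fun p => ?_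
  rw [Real.mul_iSup_of_nonneg (pow_nonneg hε _)]
  refine iSup_congr fun x => ?_
  rw [one_pow, one_mul]

omit [Fintype Γ] [DecidableEq Γ] [Fintype Γ'] [DecidableEq Γ'] [Fintype Γ''] [DecidableEq Γ''] in
/-- Substitutions compose: `map g (map f a) = map (g ∘ f) a`. [folklore] -/
theorem map_map_eq_map_comp {R : Type*} [CommRing R] (f : (Γ' → R) →ₗ[R] (Γ → R)) (g : (Γ → R) →ₗ[R] (Γ'' → R))
    (a : GrassmannAlgebra R Γ') :
    ExteriorAlgebra.map g (ExteriorAlgebra.map f a) = ExteriorAlgebra.map (g ∘ₗ f) a := by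
  rw [← AlgHom.comp_apply, ExteriorAlgebra.map_comp_map]

/-- **The single-scale step read in another representation of the fields** (BGM 2006, (2.77) with (2.71a),
(2.80)–(2.82)).  Let `V = map f Ṽ` be the interaction of the physical fields (labels `Γ`) written as an EVEN
polynomial `Ṽ` without constant part of auxiliary fields (labels `Γ'`, substitution matrix `M = toMatrix' f`),
let the pulled-back covariance `C' = Mᵀ C M` be charged (`q`), in Gram form on the mixed pairs with constant `κ`,
with row and column sums of norms `≤ α`, let `ρ > 0` and `θ = eα‖Ṽ‖_h/κ² < 1` where
`‖Ṽ‖_h = normV Γ' κ ρ (m' ↦ ‖kernel Ṽ (2m')‖)`, and let the analysis map `g` (matrix `E = toMatrix' g`) satisfy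
`Σ_{X'} ‖(E M)(X'', X')‖ ≤ cr`, `Σ_{X''} ‖(E M)(X'', X')‖ ≤ cc`.  THEN `∫ dμ_C e^{-V}` is a unit and in every degree
`m + 1`, with integration weight `ε ≥ 0`,
`‖kernel (map g (effAction C V)) (m+1)‖_ε ≤ cr · cc^m · ε^m · ρ^{-(m+1)} · e‖Ṽ‖_h / (1 - θ)`.
[cite: BenfattoGiulianiMastropietro2006, (2.77) with (2.71a) and (2.80)-(2.82)] -/
theorem kernelNorm_kernel_map_effAction_le {E : Type*} [NormedAddCommGroup E] [InnerProductSpace 𝕜 E]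
    (C : Matrix Γ Γ 𝕜) (f : (Γ' → 𝕜) →ₗ[𝕜] (Γ → 𝕜)) (g : (Γ → 𝕜) →ₗ[𝕜] (Γ'' → 𝕜))
    (Vt : GrassmannAlgebra 𝕜 Γ') (hVt : Vt ∈ evenPart 𝕜 Γ') (hVt0 : constPart 𝕜 Vt = 0)
    (q : Γ' → Bool)
    (hC : ∀ X Y, q X = q Y → ((LinearMap.toMatrix' f).transpose * C * LinearMap.toMatrix' f) X Y = 0)
    (fv gv : Γ' → E) {κ : ℝ} (hκ : 0 < κ) (hf : ∀ X, q X = true → ‖fv X‖ ≤ κ) (hg : ∀ Y, q Y = false → ‖gv Y‖ ≤ κ)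
    (hGram : ∀ X Y, q X = true → q Y = false →
      contr 𝕜 ((LinearMap.toMatrix' f).transpose * C * LinearMap.toMatrix' f) X Y = ⟪fv X, gv Y⟫_𝕜)
    {α : ℝ} (hα : 0 < α)
    (hrow : ∀ X, ∑ Y, ‖((LinearMap.toMatrix' f).transpose * C * LinearMap.toMatrix' f) X Y‖ ≤ α)
    (hcol : ∀ Y, ∑ X, ‖((LinearMap.toMatrix' f).transpose * C * LinearMap.toMatrix' f) X Y‖ ≤ α)
    {ρ : ℝ} (hρ : 0 < ρ)
    (hθ : Real.exp 1 * α * normV Γ' κ ρ (fun m' => kernelNorm 1 (2 * m') (kernel 𝕜 Vt (2 * m'))) / κ ^ 2 < 1)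
    {cr cc : ℝ} (hcr0 : 0 ≤ cr) (hcc0 : 0 ≤ cc)
    (hrow' : ∀ X'', ∑ X', ‖(LinearMap.toMatrix' g * LinearMap.toMatrix' f) X'' X'‖ ≤ cr)
    (hcol' : ∀ X', ∑ X'', ‖(LinearMap.toMatrix' g * LinearMap.toMatrix' f) X'' X'‖ ≤ cc)
    {ε : ℝ} (hε : 0 ≤ ε) :
    IsUnit (effPartitionFn 𝕜 C (ExteriorAlgebra.map f Vt)) ∧ ∀ m : ℕ,
      kernelNorm ε (m + 1) (kernel 𝕜 (ExteriorAlgebra.map g (effAction 𝕜 C (ExteriorAlgebra.map f Vt))) (m + 1)) ≤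
        cr * cc ^ m * ε ^ m * (ρ⁻¹ ^ (m + 1) *
          (Real.exp 1 * normV Γ' κ ρ (fun m' => kernelNorm 1 (2 * m') (kernel 𝕜 Vt (2 * m')))) /
            (1 - Real.exp 1 * α * normV Γ' κ ρ (fun m' => kernelNorm 1 (2 * m') (kernel 𝕜 Vt (2 * m'))) / κ ^ 2)) := by
  set C' : Matrix Γ' Γ' 𝕜 := (LinearMap.toMatrix' f).transpose * C * LinearMap.toMatrix' f with hC'
  -- the single-scale step in the auxiliary representation
  obtain ⟨hunit, hbd⟩ := kernelNorm_kernel_effAction_le C' q hC fv gv hκ hf hg hGram Vt hVt hVt0 hα hrow hcol hρ hθ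
  refine ⟨by rwa [effPartitionFn_map], fun m => ?_⟩
  -- the output read through `g`: kernels of `map (g ∘ f) (effAction C' Ṽ)`
  rw [effAction_map, map_map_eq_map_comp, kernelNorm_eq_pow_mul_kernelNorm_one hε]
  have hY := kernelNorm_kernel_map_le (g ∘ₗ f) hcr0 hcc0 (ε := 1)
    (by intro X''; rw [LinearMap.toMatrix'_comp]; exact hrow' X'')
    (by intro X'; simp only [LinearMap.toMatrix'_comp]; exact hcol' X') zero_le_one (effAction 𝕜 C' Vt) m
  calc ε ^ m * kernelNorm 1 (m + 1) (kernel 𝕜 (ExteriorAlgebra.map (g ∘ₗ f) (effAction 𝕜 C' Vt)) (m + 1))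
      ≤ ε ^ m * (cr * cc ^ m * kernelNorm 1 (m + 1) (kernel 𝕜 (effAction 𝕜 C' Vt) (m + 1))) :=
        mul_le_mul_of_nonneg_left hY (pow_nonneg hε _)
    _ ≤ ε ^ m * (cr * cc ^ m * (ρ⁻¹ ^ (m + 1) *
          (Real.exp 1 * normV Γ' κ ρ (fun m' => kernelNorm 1 (2 * m') (kernel 𝕜 Vt (2 * m')))) /
            (1 - Real.exp 1 * α * normV Γ' κ ρ (fun m' => kernelNorm 1 (2 * m') (kernel 𝕜 Vt (2 * m'))) / κ ^ 2))) := by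
        exact mul_le_mul_of_nonneg_left (mul_le_mul_of_nonneg_left (hbd (Nat.succ_pos m)) (by positivity))
          (pow_nonneg hε _)
    _ = _ := by ring

end Literature.MathematicalPhysics.QuantumLattice
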